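import Summits.HodgeConjecture.HodgeConjecture.Theses.SevenfoldWeilCensus
import Summits.HodgeConjecture.HodgeConjecture.Theses.RankFourFaces
import Summits.HodgeConjecture.HodgeConjecture.Theses.ConservativityLefschetz
import Summits.HodgeConjecture.HodgeConjecture.Theses.PadicSemiregularLift
import Summits.HodgeConjecture.HodgeConjecture.Theorems.AbelianComplement.Negative.RankFourFacesSummitEquivalence
import Literature.AlgebraicGeometry.Motives.AbelianVarietyProjectiveChart
import HarnessLib

/-!
# `AbelianComplement` (stmt-HodgeConjecture-15889) — BC2 redirect, BRIDGE split (strategist q1, 7fold)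

Crux `Summit.HodgeConjecture.HodgeConjecture.Theses.SevenfoldWeilCensus.AbelianComplement`
(verbatim twin: `…Theses.RankFourFaces.AbelianComplement`) is kernel-checked EQUIVALENT to the summit
(`Theorems.AbelianComplement.Negative.abelianComplement_iff_hodgeConjecture`, unconditional: the
`(X × ℙ¹) × ℙ¹` product trick re-enters the excluded abelian locus). RESTATED IS A REDIRECT
(human ruling 2026-08-16): the item passes BC2 iff its OWN decomposition passes one level down.

This file is the kernel-checked ASSEMBLY of the decomposition chosen by the strategist seat
`cstrat-stmt-HodgeConjecture-15889-q1` — the BRIDGE split through the abelian milestone: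

* piece 1 `HodgeAbelianVarieties` — the Hodge conjecture for every complex abelian variety
  (text = item stmt-HodgeConjecture-1333 = `Theses.PadicSemiregularLift.HodgeAbelianVarieties`,
  verbatim; `hodgeAbelianVarieties_iff` is `Iff.rfl`);
* piece 2 `AbelianToHodge` — HC for abelian varieties implies HC
  (text = item stmt-HodgeConjecture-10452 = `Theses.ConservativityLefschetz.AbelianComplement`,
  verbatim; `abelianToHodge_iff` is `Iff.rfl`; its registered line is
  `Cruxes/AbelianComplement/Lines/abelian_domination.lean`, skeleton sha 99fa6985…, 3 stubs);
* `AbelianComplement_of_subs : HodgeAbelianVarieties → AbelianToHodge → AbelianComplement`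
  (the glue, by NAME on the SevenfoldWeilCensus decl; `AbelianComplementRFF_of_subs` on the
  RankFourFaces twin) and the exactness `subs_of_abelianComplement` (the split loses nothing);
* informational converses `S → pieceᵢ` (both pieces are consequences of the summit, as every
  statement weaker than `S` is; neither gives `S` or the crux alone — see `BC2-PROBES-bridge.md`).

No new statement is minted: both pieces are EXISTING ledger items, so the split is pure
deduplication of the summit-equivalent node onto the two items the portfolio already staffs.
Everything here is proved; standard axioms only.
-/

set_option linter.dupNamespace false

namespace Summit.HodgeConjecture.HodgeConjecture.Cruxes.AbelianComplement.BridgeSplit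

open Literature.AlgebraicGeometry.Motives Literature.AlgebraicGeometry.HodgeTheory

/-- **Piece 1 (support; the abelian milestone)** — the Hodge conjecture for every complex abelian
variety. Text VERBATIM item stmt-HodgeConjecture-1333
(`Theses.PadicSemiregularLift.HodgeAbelianVarieties`). [cite: Deligne1982HodgeCycles] -/
def HodgeAbelianVarieties : Prop :=
  ∀ A : Literature.AlgebraicGeometry.Motives.AbelianVariety ℂ, Literature.AlgebraicGeometry.HodgeTheory.HodgeConjectureFor A.dim A.X

/-- **Piece 2 (crux, declared residual; the bridge)** — the Hodge conjecture for all smooth projective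
complex varieties GIVEN it for every complex abelian variety. Text VERBATIM item
stmt-HodgeConjecture-10452 (`Theses.ConservativityLefschetz.AbelianComplement`). [cite: Andre1996Motifs] -/
def AbelianToHodge : Prop :=
  (∀ A : Literature.AlgebraicGeometry.Motives.AbelianVariety ℂ, Literature.AlgebraicGeometry.Motives.IsSmoothProjective A.dim A.X → Literature.AlgebraicGeometry.HodgeTheory.HodgeConjectureFor A.dim A.X) → HodgeConjecture

/-- Piece 1 is item 1333's decl, on the nose. -/
theorem hodgeAbelianVarieties_iff :
    HodgeAbelianVarieties ↔ Theses.PadicSemiregularLift.HodgeAbelianVarieties := Iff.rfl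

/-- Piece 2 is item 10452's decl, on the nose. -/
theorem abelianToHodge_iff :
    AbelianToHodge ↔ Theses.ConservativityLefschetz.AbelianComplement := Iff.rfl

/-- The two route decls of item 15889 are the same proposition. -/
theorem sevenfold_iff_rankFourFaces :
    Theses.SevenfoldWeilCensus.AbelianComplement ↔ Theses.RankFourFaces.AbelianComplement := Iff.rfl

/-- **THE GLUE** `X₁ → X₂ → X` of the bridge split, concluding the SevenfoldWeilCensus route decl by
name: feed piece 2 with piece 1 (dropping the automatic smooth-projective binder) and restrict the
resulting summit statement to the non-abelian `X`. -/
theorem AbelianComplement_of_subs (h₁ : HodgeAbelianVarieties) (h₂ : AbelianToHodge) :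
    Theses.SevenfoldWeilCensus.AbelianComplement :=
  fun _ _ hX _ ↦ h₂ (fun A _ ↦ h₁ A) hX

/-- The same glue on the verbatim twin decl of route RankFourFaces. -/
theorem AbelianComplementRFF_of_subs (h₁ : HodgeAbelianVarieties) (h₂ : AbelianToHodge) :
    Theses.RankFourFaces.AbelianComplement :=
  fun _ _ hX _ ↦ h₂ (fun A _ ↦ h₁ A) hX

/-- **THE GLUE over the REGISTERED item decls** (pieces named as the ledger knows them:
stmt-HodgeConjecture-1333 = `PadicSemiregularLift.HodgeAbelianVarieties`, stmt-HodgeConjecture-10452 =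
`ConservativityLefschetz.AbelianComplement`), concluding the SevenfoldWeilCensus decl of item 15889. -/
theorem AbelianComplement_of_items (h₁ : Theses.PadicSemiregularLift.HodgeAbelianVarieties)
    (h₂ : Theses.ConservativityLefschetz.AbelianComplement) :
    Theses.SevenfoldWeilCensus.AbelianComplement :=
  fun _ _ hX _ ↦ h₂ (fun A _ ↦ h₁ A) hX

/-- The same over the registered item decls, concluding the RankFourFaces twin decl of item 15889. -/
theorem AbelianComplementRFF_of_items (h₁ : Theses.PadicSemiregularLift.HodgeAbelianVarieties)
    (h₂ : Theses.ConservativityLefschetz.AbelianComplement) :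
    Theses.RankFourFaces.AbelianComplement :=
  fun _ _ hX _ ↦ h₂ (fun A _ ↦ h₁ A) hX

/-- **Exactness of the split**: the crux gives back both pieces (through the tree's unconditional
`hodgeConjecture_of_abelianComplement` and `AbelianVariety.isSmoothProjective_holds`), so
`X ↔ X₁ ∧ X₂` — the decomposition discards nothing. -/
theorem subs_of_abelianComplement (h : Theses.SevenfoldWeilCensus.AbelianComplement) :
    HodgeAbelianVarieties ∧ AbelianToHodge :=
  have H : HodgeConjecture :=
    Theorems.AbelianComplement.Negative.hodgeConjecture_of_abelianComplement
      (show Theses.RankFourFaces.AbelianComplement from fun _ _ hX hA ↦ h hX hA)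
  ⟨fun _ ↦ H AbelianVariety.isSmoothProjective_holds, fun _ ↦ H⟩

/-- `X ↔ X₁ ∧ X₂`. -/
theorem abelianComplement_iff_subs :
    Theses.SevenfoldWeilCensus.AbelianComplement ↔ HodgeAbelianVarieties ∧ AbelianToHodge :=
  ⟨subs_of_abelianComplement, fun h ↦ AbelianComplement_of_subs h.1 h.2⟩

/-- Informational converse (BC2, `S → X₁`): piece 1 is a consequence of the summit. -/
theorem hodgeAbelianVarieties_of_hodgeConjecture (H : HodgeConjecture) : HodgeAbelianVarieties :=
  fun _ ↦ H AbelianVariety.isSmoothProjective_holds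

/-- Informational converse (BC2, `S → X₂`): piece 2 is a consequence of the summit (trivially). -/
theorem abelianToHodge_of_hodgeConjecture (H : HodgeConjecture) : AbelianToHodge := fun _ ↦ H

/-- The bridge is modus ponens at summit level: `X₁ → X₂ → S` (so the pair is JOINTLY the summit —
the conjunct this split attacks is `X₁`, the declared residual is `X₂`). -/
theorem hodgeConjecture_of_subs (h₁ : HodgeAbelianVarieties) (h₂ : AbelianToHodge) : HodgeConjecture :=
  h₂ fun A _ ↦ h₁ A

end Summit.HodgeConjecture.HodgeConjecture.Cruxes.AbelianComplement.BridgeSplit
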